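import Mathlib.Combinatorics.SetFamily.FourFunctions
import Literature.Probability.LatticeModels.RandomClusterFKG
import Mathlib.Data.Real.Basic
import Mathlib.Analysis.SpecialFunctions.Pow.Real
import HarnessLib

/-!
# FK-continuity transplant, FO-06/FO-10 (infinite-volume structure): more wiring raises increasing expectations —
# the powerset tilt inequality behind Grimmett 2006, Lemma (4.14)(b), for GENERAL boundary-condition graphs

Registered R80 (cell INBOX l.5895, 2026-08-23); registry row FO-10b-g407k; label KCM-B (coordinator fk-4 g175).
Cell `fk-continuity` (bschramm), FO-10b lineage; support file for the FK-continuity transplant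
(`--supports stmt-CriticalPhenomena-4575`); builds on p205010 (kernel theorem, internal audit signed; external expert
review pending). No named facts, no sorries, standard axioms. Banked infinite-volume structure; not an END-STATE
dependency of the cell (not consumed by `_r3`); it says nothing about FH / TP_FK or continuity at `p_c`.

* `powerset_tilt_sum_mul_sum_le` — for `0 ≤ p ≤ 1`, `q ≥ 1`, a finite edge set `U`, exponents `k, k'` on the
  patterns `η ⊆ U` with `k` supermodular and `k' - k` monotone, and a nonnegative monotone `f`:
  `(∑ w_k f)(∑ w_{k'}) ≤ (∑ w_k)(∑ w_{k'} f)`, `w_k(η) = p^{|η|}(1-p)^{|U ∖ η|} q^{k(η)}` — Ahlswede–Daykin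
  (Mathlib `Finset.four_functions_theorem` on the powerset algebra; no finiteness of the index type);
* `comap_openGraph_inter`, `comap_openGraph_union`, `card_cc_comap_sup_supermodular`, `card_cc_comap_add_sup_le` —
  the exponents `k_R(η) = #components of (openGraph η).comap φ ⊔ R` on a finite vertex type satisfy exactly these
  hypotheses for every pair of boundary-condition graphs `R ≤ R ⊔ R'`.

## References

* G. Grimmett, *The Random-Cluster Model*, Springer 2006: Thm. (3.8) eqs. (3.11)–(3.12), Lemma (4.14)(b).
  [Grimmett2006]
* R. Ahlswede, D. Daykin, Z. Wahrsch. verw. Gebiete 43 (1978) 183–185 (four functions theorem). [AhlswedeDaykin1978]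
-/

noncomputable section

open Finset

namespace Summit.CriticalPhenomena.PercolationContinuityZ3.Theorems.FK

variable {ι : Type*} [DecidableEq ι]

/-- **Powerset tilt inequality** (the finite-volume core of Grimmett 2006, Lemma (4.14)(b): more wiring raises
increasing expectations). For `0 ≤ p ≤ 1`, `q ≥ 1`, a finite edge set `U`, exponents `k, k' : Finset ι → ℕ` with
`k` supermodular on the subsets of `U` and `k' - k` monotone there (`a ⊆ b ⊆ U ⇒ k b + k' a ≤ k a + k' b`), and a
nonnegative monotone `f`, the weights `w_k(η) = p^{|η|}(1-p)^{|U ∖ η|} q^{k(η)}` satisfy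
`(∑_{η ⊆ U} w_k f)(∑_{η ⊆ U} w_{k'}) ≤ (∑_{η ⊆ U} w_k)(∑_{η ⊆ U} w_{k'} f)` (Ahlswede–Daykin with
`f₁ = w_k f`, `f₂ = w_{k'}`, `f₃ = w_k`, `f₄ = w_{k'} f`: the exponent condition `k s + k' t ≤ k (s ∩ t) + k' (s ∪ t)`
is the sum of the supermodularity of `k` and the monotonicity of `k' - k`). [cite: Grimmett2006, Lemma (4.14)(b), Thm. (3.8)] -/
theorem powerset_tilt_sum_mul_sum_le (U : Finset ι) {p q : ℝ} (hp : p ∈ Set.Icc (0 : ℝ) 1) (hq : 1 ≤ q)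
    (k k' : Finset ι → ℕ) (hk : ∀ ⦃a⦄, a ⊆ U → ∀ ⦃b⦄, b ⊆ U → k a + k b ≤ k (a ∩ b) + k (a ∪ b))
    (hkk' : ∀ ⦃a b⦄, a ⊆ b → b ⊆ U → k b + k' a ≤ k a + k' b)
    {f : Finset ι → ℝ} (hf0 : ∀ η, 0 ≤ f η) (hf : Monotone f) :
    (∑ η ∈ U.powerset, p ^ η.card * (1 - p) ^ (U \ η).card * q ^ k η * f η) *
      (∑ η ∈ U.powerset, p ^ η.card * (1 - p) ^ (U \ η).card * q ^ k' η) ≤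
    (∑ η ∈ U.powerset, p ^ η.card * (1 - p) ^ (U \ η).card * q ^ k η) *
      (∑ η ∈ U.powerset, p ^ η.card * (1 - p) ^ (U \ η).card * q ^ k' η * f η) := by
  classical
  have h0p : 0 ≤ p := hp.1
  have h1p : 0 ≤ 1 - p := sub_nonneg.2 hp.2
  have hq0 : 0 ≤ q := zero_le_one.trans hq
  set w : Finset ι → ℝ := fun η => p ^ η.card * (1 - p) ^ (U \ η).card * q ^ k η with hw
  set w' : Finset ι → ℝ := fun η => p ^ η.card * (1 - p) ^ (U \ η).card * q ^ k' η with hw'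
  have hw0 : ∀ η, 0 ≤ w η := fun η => by simp only [hw]; positivity
  have hw'0 : ∀ η, 0 ≤ w' η := fun η => by simp only [hw']; positivity
  -- the four-functions condition on the subsets of `U`
  have hcond : ∀ ⦃s⦄, s ⊆ U → ∀ ⦃t⦄, t ⊆ U →
      (fun η => w η * f η) s * w' t ≤ w (s ∩ t) * (fun η => w' η * f η) (s ∪ t) := by
    intro s hs t ht
    dsimp only
    have hcard : s.card + t.card = (s ∩ t).card + (s ∪ t).card := by
      rw [add_comm (s ∩ t).card, Finset.card_union_add_card_inter]
    have hcard' : (U \ s).card + (U \ t).card = (U \ (s ∩ t)).card + (U \ (s ∪ t)).card := by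
      rw [sdiff_inter_distrib_right, Finset.sdiff_union_distrib, Finset.card_union_add_card_inter]
    have hexp : k s + k' t ≤ k (s ∩ t) + k' (s ∪ t) := by
      have h1 := hk hs ht
      have h2 := hkk' (Finset.subset_union_right : t ⊆ s ∪ t) (Finset.union_subset hs ht)
      omega
    have hww : w s * w' t ≤ w (s ∩ t) * w' (s ∪ t) := by
      simp only [hw, hw']
      calc p ^ s.card * (1 - p) ^ (U \ s).card * q ^ k s * (p ^ t.card * (1 - p) ^ (U \ t).card * q ^ k' t)
          = p ^ (s.card + t.card) * (1 - p) ^ ((U \ s).card + (U \ t).card) * q ^ (k s + k' t) := by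
            simp only [pow_add]; ring
        _ ≤ p ^ (s.card + t.card) * (1 - p) ^ ((U \ s).card + (U \ t).card) * q ^ (k (s ∩ t) + k' (s ∪ t)) := by
            gcongr
        _ = p ^ ((s ∩ t).card + (s ∪ t).card) * (1 - p) ^ ((U \ (s ∩ t)).card + (U \ (s ∪ t)).card) *
              q ^ (k (s ∩ t) + k' (s ∪ t)) := by rw [hcard, hcard']
        _ = _ := by simp only [pow_add]; ring
    have hfs : f s ≤ f (s ∪ t) := hf Finset.subset_union_left
    calc w s * f s * w' t = (w s * w' t) * f s := by ring
      _ ≤ (w (s ∩ t) * w' (s ∪ t)) * f (s ∪ t) :=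
          mul_le_mul hww hfs (hf0 s) (mul_nonneg (hw0 _) (hw'0 _))
      _ = w (s ∩ t) * (w' (s ∪ t) * f (s ∪ t)) := by ring
  have key := Finset.four_functions_theorem U (f₁ := fun η => w η * f η) (f₂ := w') (f₃ := w)
    (f₄ := fun η => w' η * f η) (fun η => mul_nonneg (hw0 η) (hf0 η)) (fun η => hw'0 η) (fun η => hw0 η)
    (fun η => mul_nonneg (hw'0 η) (hf0 η)) hcond (subset_refl U.powerset) (subset_refl U.powerset)
  simpa only [Finset.powerset_infs_powerset_self, Finset.powerset_sups_powerset_self, hw, hw'] using key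


/-! ### The exponents: cluster counts of a pattern pulled back to a finite vertex type, with extra wiring -/

section Comap

open Literature.Probability.Percolation Literature.Probability.LatticeModels

variable {V W : Type*} [Finite W] (φ : W → V)

omit [Finite W] in
/-- Pulling back the open graph of an intersection of configurations. [folklore] -/
theorem comap_openGraph_inter (a b : BondConfig V) :
    (openGraph (a ∩ b)).comap φ = (openGraph a).comap φ ⊓ (openGraph b).comap φ := by
  ext x y
  simp only [SimpleGraph.comap_adj, openGraph_adj, Set.mem_inter_iff, SimpleGraph.inf_adj]
  tauto

omit [Finite W] in
/-- Pulling back the open graph of a union of configurations. [folklore] -/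
theorem comap_openGraph_union (a b : BondConfig V) :
    (openGraph (a ∪ b)).comap φ = (openGraph a).comap φ ⊔ (openGraph b).comap φ := by
  ext x y
  simp only [SimpleGraph.comap_adj, openGraph_adj, Set.mem_union, SimpleGraph.sup_adj]
  tauto

/-- **Supermodularity of the pulled-back cluster count with extra wiring `R`**: for edge finsets `a, b`,
`k(a) + k(b) ≤ k(a ∩ b) + k(a ∪ b)` where `k(η) = #components of (openGraph η).comap φ ⊔ R` on the finite type `W`.
[cite: Grimmett2006, Thm. 3.8, eq. (3.12)] -/
theorem card_cc_comap_sup_supermodular [DecidableEq V] (R : SimpleGraph W) (a b : Finset (Sym2 V)) :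
    Nat.card ((openGraph (↑a : BondConfig V)).comap φ ⊔ R).ConnectedComponent +
        Nat.card ((openGraph (↑b : BondConfig V)).comap φ ⊔ R).ConnectedComponent ≤
      Nat.card ((openGraph (↑(a ∩ b) : BondConfig V)).comap φ ⊔ R).ConnectedComponent +
        Nat.card ((openGraph (↑(a ∪ b) : BondConfig V)).comap φ ⊔ R).ConnectedComponent := by
  rw [Finset.coe_inter, Finset.coe_union, comap_openGraph_inter, comap_openGraph_union, sup_inf_right,
    sup_sup_distrib_right]
  exact card_connectedComponent_supermodular _ _

/-- **The merges of a further wiring `R'` are antitone**: for edge finsets `a ⊆ b`,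
`k_R(b) + k_{R ⊔ R'}(a) ≤ k_R(a) + k_{R ⊔ R'}(b)`. [cite: Grimmett2006, Thm. 3.8, eq. (3.12)] -/
theorem card_cc_comap_add_sup_le [DecidableEq V] (R R' : SimpleGraph W) {a b : Finset (Sym2 V)} (h : a ⊆ b) :
    Nat.card ((openGraph (↑b : BondConfig V)).comap φ ⊔ R).ConnectedComponent +
        Nat.card ((openGraph (↑a : BondConfig V)).comap φ ⊔ (R ⊔ R')).ConnectedComponent ≤
      Nat.card ((openGraph (↑a : BondConfig V)).comap φ ⊔ R).ConnectedComponent +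
        Nat.card ((openGraph (↑b : BondConfig V)).comap φ ⊔ (R ⊔ R')).ConnectedComponent := by
  have hle : (openGraph (↑a : BondConfig V)).comap φ ⊔ R ≤ (openGraph (↑b : BondConfig V)).comap φ ⊔ R := by
    refine sup_le_sup_right (fun x y hxy => ?_) R
    rw [SimpleGraph.comap_adj, openGraph_adj] at hxy ⊢
    exact ⟨Finset.mem_coe.2 (h (Finset.mem_coe.1 hxy.1)), hxy.2⟩
  have h1 := card_connectedComponent_supermodular ((openGraph (↑b : BondConfig V)).comap φ ⊔ R)
    ((openGraph (↑a : BondConfig V)).comap φ ⊔ R ⊔ R')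
  have h2 : ((openGraph (↑b : BondConfig V)).comap φ ⊔ R) ⊔ ((openGraph (↑a : BondConfig V)).comap φ ⊔ R ⊔ R') =
      (openGraph (↑b : BondConfig V)).comap φ ⊔ (R ⊔ R') := by
    rw [← sup_assoc, sup_eq_left.2 hle, sup_assoc]
  have h3 : Nat.card (((openGraph (↑b : BondConfig V)).comap φ ⊔ R) ⊓
        ((openGraph (↑a : BondConfig V)).comap φ ⊔ R ⊔ R')).ConnectedComponent ≤
      Nat.card ((openGraph (↑a : BondConfig V)).comap φ ⊔ R).ConnectedComponent :=
    SimpleGraph.ConnectedComponent.card_le_card_of_le (le_inf hle le_sup_left)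
  rw [h2] at h1
  rw [← sup_assoc]
  omega

end Comap

end Summit.CriticalPhenomena.PercolationContinuityZ3.Theorems.FK

end
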